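import Literature.Analysis.FunctionSpaces.LittlewoodPaleyHolderDirect
import Literature.Analysis.FunctionSpaces.LittlewoodPaleyHolderHeat
import Mathlib.Analysis.Calculus.SmoothSeries
import HarnessLib

/-!
# `B^{k+r}_{∞,∞} = C^{k,r}_b` (Triebel 1983, Thm. 2.5.7): the converse inclusion and the discharge of
the named fact `memBesov_top_top_iff_memContDiffHolder`

Sibling proof file of `Literature/Analysis/FunctionSpaces/LittlewoodPaley.lean` (blocks
`Literature.Analysis.FunctionSpaces.lpBlock = Δ̇_j`, cut-offs
`Literature.Analysis.FunctionSpaces.lowFreqCutoff = Ṡ_j`, `L^p` norms of distributions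
`Literature.Analysis.FunctionSpaces.eLpNormDistrib`, the inhomogeneous class
`Literature.Analysis.FunctionSpaces.MemBesov`) and of `Literature/Analysis/FunctionSpaces/HolderNorm.lean`
(the class `Literature.Analysis.FunctionSpaces.MemContDiffHolder k r f`: `C^k`, all derivatives of
order `≤ k` bounded, `D^k f` `r`-Hölder), continuing `LittlewoodPaleyHolderDirect.lean`
(`C^{k,r}_b ⊂ B^{k+r}_{∞,∞}`: vanishing moments of the Littlewood–Paley kernels and Taylor's formula
with Hölder remainder) and `LittlewoodPaleyHolderHeat.lean` (smooth representatives `g_j` of the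
blocks `Δ̇_j u ∈ L^∞` with Bernstein's bounds `‖Dᵐ g_j‖_∞ ≤ A_m 2^{jm} C ‖Δ̇_j u‖_∞`, and of `Ṡ₀ u`,
through the heat flow). Everything here is **proved**:

* `Literature.Analysis.FunctionSpaces.exists_memContDiffHolder_coe_eq_of_memBesov_top_top` —
  **`B^{k+r}_{∞,∞} ⊂ C^{k,r}_b`** (`k ∈ ℕ`, `0 < r < 1`): a tempered distribution `u` with
  `‖Ṡ₀ u‖_{L^∞} + sup_{j ≥ 1} 2^{j(k+r)} ‖Δ̇_j u‖_{L^∞} < ∞` is the distribution of a `C^k` function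
  `f = g₀ + ∑_{j ≥ 1} g_j` all of whose derivatives of order `≤ k` are bounded and whose `k`-th
  derivative is `r`-Hölder (Grafakos, *Modern Fourier Analysis*, 3rd ed., proof of Thm. 1.4.9;
  Triebel 1983, proof of Prop. 2.5.7, Step 1, run with the weights `2^{j(k+r)}`):
  the series of `m`-th derivatives converges normally for `m ≤ k`
  (`∑_j 2^{jm} 2^{-j(k+r)} < ∞`; Mathlib's `contDiff_tsum`, `iteratedFDeriv_tsum_apply`), and for
  `h = ‖x - y‖` the `k`-th derivatives satisfy
  `‖D^k g_j(x) - D^k g_j(y)‖ ≤ min(2 ‖D^k g_j‖_∞, h ‖D^{k+1} g_j‖_∞) ≲ min(2^{-jr}, h 2^{j(1-r)})`,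
  whose sum over `j` is `≲ h^r` (`Literature.Analysis.FunctionSpaces.exists_tsum_min_mul_rpow_neg_le`;
  this is where `0 < r < 1` enters). Finally `[f] = u` because the partial sums represent
  `Ṡ₀ u + ∑_{j=1}^m Δ̇_j u = Ṡ_m u → u` in `𝓢'`
  (`Literature.Analysis.FunctionSpaces.tendsto_lowFreqCutoff_atTop_distribution`) and converge to
  `f` uniformly, hence in `L^∞` and in `𝓢'`.
* `Literature.Analysis.FunctionSpaces.memBesov_top_top_iff_memContDiffHolder_holds :
  memBesov_top_top_iff_memContDiffHolder` — the discharge, assembling the above with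
  `Literature.Analysis.FunctionSpaces.memBesov_top_top_coe_of_memContDiffHolder`
  (`LittlewoodPaleyHolderDirect.lean`); valid in every finite dimension (also `E = {0}`) and for
  every complex Banach space `F`. The case `k = 0` is the sibling fact
  `memBesov_top_top_iff_memBoundedHolder` (`LittlewoodPaleyHolderProofs.lean`).

## Source

H. Triebel, *Theory of Function Spaces*, Monographs in Mathematics 78, Birkhäuser (1983),
doi:10.1007/978-3-0346-0416-1 (held: `book:triebel1983-theory-function-spaces`):

* §2.2.2, eq. (3) (PDF p. 151): for `0 < s ∉ ℕ`, `s = [s] + {s}`,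
  `C^s(ℝⁿ) = {f ∈ C^{[s]}(ℝⁿ) : ‖f | C^{[s]}‖ + ∑_{|α| = [s]} sup_{x ≠ y} |D^α f(x) - D^α f(y)| / |x - y|^{{s}} < ∞}`,
  `C^m` being (2.2.2/1) the functions with bounded uniformly continuous derivatives `D^α f`,
  `|α| ≤ m`;
* §2.5.7, Theorem (ii), eq. (6) (PDF p. 219): `𝒞^s(ℝⁿ) = B^s_{∞,∞}(ℝⁿ)` for `s > 0`, and eq. (9):
  `C^s(ℝⁿ) = 𝒞^s(ℝⁿ)` if `0 < s ≠` integer (equivalently §2.5.12, Corollary (ii), eq. (22), PDF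
  p. 245, with Remark 4); `B^s_{p,q}` being defined (2.3.1) through any smooth dyadic resolution of
  unity `{φ_k} ∈ Φ(ℝⁿ)`, of which the tree's `(Ṡ₀, (Δ̇_j)_{j ≥ 1})` is one; §2.5.7, Proposition
  (proof, Step 1: the series `∑_k F⁻¹φ_k F f` converges in `L^∞`, its terms being smooth and
  bounded with their derivatives by (1.4.1/3)).

In the tree's form: for `k ∈ ℕ`, `0 < r < 1` and `u ∈ 𝓢'(E, F)` (`E` a finite-dimensional real inner
product space, `F` a complex Banach space), `MemBesov (k + r) ∞ ∞ u` iff `u` is the distribution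
of some `f` with `MemLp f ∞` and `MemContDiffHolder k r f` (derivatives over `ℝ` through
`NormedSpace.complexToReal`; the Fréchet-derivative formulation of `C^{k,r}_b` is equivalent to
Triebel's partial-derivative one in finite dimension, and bounded functions with bounded derivative,
resp. Hölder functions, are uniformly continuous). [cite: Triebel1983, Thm. 2.5.7]

* L. Grafakos, *Modern Fourier Analysis*, 3rd ed., GTM 250, Springer (2014), Thm. 1.4.9 and its
  proof, (1.4.26)–(1.4.30) (held as `book:grafakos2009-modern-fourier-analysis`, PDF pp. 98–100) —
  the architecture of the converse followed here (with derivatives in place of differences).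
-/

noncomputable section

open MeasureTheory FourierTransform SchwartzMap Real Filter Topology Function TemperedDistribution
open scoped SchwartzMap ENNReal NNReal FourierTransform RealInnerProductSpace Convolution

namespace Literature.Analysis.FunctionSpaces

/-! ## Elementary inequalities -/

section Aux

variable {X : Type*} [NormedAddCommGroup X] {Y : Type*} [NormedAddCommGroup Y]

/-- A bounded Lipschitz map is `r`-Hölder for every `0 < r ≤ 1`:
`‖φ x - φ y‖ ≤ (L + 2B) ‖x - y‖^r` if `‖φ x - φ y‖ ≤ L ‖x - y‖` and `‖φ‖ ≤ B` (split at
`‖x - y‖ = 1`). [folklore] -/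
theorem norm_sub_le_add_mul_rpow_of_lipschitz_of_bound {φ : X → Y} {L B r : ℝ} (hL : 0 ≤ L)
    (hlip : ∀ x y, ‖φ x - φ y‖ ≤ L * ‖x - y‖) (hB : ∀ x, ‖φ x‖ ≤ B) (hr0 : 0 ≤ r) (hr1 : r ≤ 1)
    (x y : X) : ‖φ x - φ y‖ ≤ (L + 2 * B) * ‖x - y‖ ^ r := by
  have hB0 : 0 ≤ B := (norm_nonneg _).trans (hB x)
  rcases le_or_gt ‖x - y‖ 1 with h | h
  · calc ‖φ x - φ y‖ ≤ L * ‖x - y‖ := hlip x y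
      _ ≤ L * ‖x - y‖ ^ r := by
          gcongr
          exact Real.self_le_rpow_of_le_one (norm_nonneg _) h hr1
      _ ≤ (L + 2 * B) * ‖x - y‖ ^ r := by
          gcongr
          linarith
  · calc ‖φ x - φ y‖ ≤ ‖φ x‖ + ‖φ y‖ := norm_sub_le _ _
      _ ≤ B + B := add_le_add (hB x) (hB y)
      _ = (2 * B) * 1 := by ring
      _ ≤ (L + 2 * B) * ‖x - y‖ ^ r := by
          gcongr
          · linarith
          · exact Real.one_le_rpow h.le hr0

/-- `min(a p, b q) ≤ max(a, b) min(p, q)` for nonnegative reals. [folklore] -/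
theorem min_mul_le_max_mul_min (a b : ℝ) {p q : ℝ} (hp : 0 ≤ p) (hq : 0 ≤ q) :
    min (a * p) (b * q) ≤ max a b * min p q := by
  rcases le_or_gt p q with h | h
  · rw [min_eq_left h]
    exact (min_le_left _ _).trans (mul_le_mul_of_nonneg_right (le_max_left _ _) hp)
  · rw [min_eq_right h.le]
    exact (min_le_right _ _).trans (mul_le_mul_of_nonneg_right (le_max_right _ _) hq)

/-- The dyadic term of the Hölder estimate against the summand of
`Literature.Analysis.FunctionSpaces.exists_tsum_min_mul_rpow_neg_le`: for `h > 0`, `j ∈ ℤ`,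
`min(2 · 2^{-jr}, h 2^{j(1-r)}) ≤ 2 h^r · min(2^j h, 1) (2^j h)^{-r}`. [folklore] -/
theorem min_two_rpow_le_two_mul_rpow_mul (j : ℤ) (r : ℝ) {h : ℝ} (hh : 0 < h) :
    min (2 * (2 : ℝ) ^ (-((j : ℝ) * r))) (h * (2 : ℝ) ^ ((j : ℝ) * (1 - r))) ≤
      2 * h ^ r * (min ((2 : ℝ) ^ j * h) 1 * ((2 : ℝ) ^ j * h) ^ (-r)) := by
  have h2j : (0 : ℝ) < (2 : ℝ) ^ j := zpow_pos two_pos _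
  have hc : 0 < (2 : ℝ) ^ j * h := mul_pos h2j hh
  -- `(2^j h)^{-r} h^r = 2^{-jr}`
  have hkey : h ^ r * ((2 : ℝ) ^ j * h) ^ (-r) = (2 : ℝ) ^ (-((j : ℝ) * r)) := by
    rw [Real.mul_rpow h2j.le hh.le, Real.rpow_neg hh.le, ← Real.rpow_intCast, ← Real.rpow_mul zero_le_two,
      show (j : ℝ) * -r = -((j : ℝ) * r) by ring]
    field_simp [(Real.rpow_pos_of_pos hh r).ne']
  have hsplit : (2 : ℝ) ^ ((j : ℝ) * (1 - r)) = (2 : ℝ) ^ j * (2 : ℝ) ^ (-((j : ℝ) * r)) := by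
    rw [← Real.rpow_intCast, ← Real.rpow_add two_pos]
    congr 1
    ring
  rcases le_or_gt ((2 : ℝ) ^ j * h) 1 with hle | hlt
  · rw [min_eq_left hle]
    calc min (2 * (2 : ℝ) ^ (-((j : ℝ) * r))) (h * (2 : ℝ) ^ ((j : ℝ) * (1 - r)))
        ≤ h * (2 : ℝ) ^ ((j : ℝ) * (1 - r)) := min_le_right _ _
      _ ≤ 2 * (h * (2 : ℝ) ^ ((j : ℝ) * (1 - r))) := by
          have : 0 ≤ h * (2 : ℝ) ^ ((j : ℝ) * (1 - r)) := by positivity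
          linarith
      _ = 2 * h ^ r * ((2 : ℝ) ^ j * h * ((2 : ℝ) ^ j * h) ^ (-r)) := by
          rw [hsplit, ← hkey]; ring
  · rw [min_eq_right hlt.le, one_mul]
    calc min (2 * (2 : ℝ) ^ (-((j : ℝ) * r))) (h * (2 : ℝ) ^ ((j : ℝ) * (1 - r)))
        ≤ 2 * (2 : ℝ) ^ (-((j : ℝ) * r)) := min_le_left _ _
      _ = 2 * h ^ r * ((2 : ℝ) ^ j * h) ^ (-r) := by rw [← hkey]; ring

/-- `2^{j(m - s)} = (2^{m-s})^j` for natural `j` (real exponents). [folklore] -/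
theorem two_rpow_natCast_mul (j : ℕ) (t : ℝ) : (2 : ℝ) ^ ((j : ℝ) * t) = ((2 : ℝ) ^ t) ^ j := by
  rw [mul_comm, Real.rpow_mul zero_le_two, Real.rpow_natCast]

end Aux

/-! ## Two bookkeeping lemmas (private twins of lemmas of `LittlewoodPaleyHolderProofs.lean`) -/

section Twins

variable {E : Type*} [NormedAddCommGroup E] [InnerProductSpace ℝ E] [FiniteDimensional ℝ E]
  [MeasurableSpace E] [BorelSpace E] {F : Type*} [NormedAddCommGroup F] [NormedSpace ℂ F]
  [CompleteSpace F]

/-- The weighted sup bounds each block: `‖Δ̇_{n+1} u‖_{L^p} ≤ 2^{-(n+1)s} sup_m 2^{(m+1)s} ‖Δ̇_{m+1} u‖_{L^p}`.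
(Private twin of `eLpNormDistrib_lpBlock_succ_le` of `LittlewoodPaleyHolderProofs.lean`, not
imported here.) [folklore] -/
private theorem eLpNormDistrib_lpBlock_succ_le' (s : ℝ) (p : ℝ≥0∞) [Fact (1 ≤ p)] (u : 𝓢'(E, F)) (n : ℕ) :
    eLpNormDistrib p (lpBlock ((n : ℤ) + 1) u) ≤
      (2 : ℝ≥0∞) ^ (-((((n : ℤ) + 1 : ℤ) : ℝ) * s)) * eLpNorm (lpBlockWeightSucc s p u) ∞ Measure.count := by
  have h1 : lpBlockWeightSucc s p u n ≤ eLpNorm (lpBlockWeightSucc s p u) ∞ Measure.count := by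
    rw [eLpNorm_exponent_top, eLpNormEssSup_count]
    simp only [enorm_eq_self]
    exact le_iSup (fun n => lpBlockWeightSucc s p u n) n
  rw [lpBlockWeightSucc, lpBlockWeight] at h1
  have h2 : (2 : ℝ≥0∞) ^ (-((((n : ℤ) + 1 : ℤ) : ℝ) * s)) * ((2 : ℝ≥0∞) ^ ((((n : ℤ) + 1 : ℤ) : ℝ) * s) *
      eLpNormDistrib p (lpBlock ((n : ℤ) + 1) u)) = eLpNormDistrib p (lpBlock ((n : ℤ) + 1) u) := by
    rw [← mul_assoc, ← ENNReal.rpow_add _ _ two_ne_zero ENNReal.ofNat_ne_top, neg_add_cancel,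
      ENNReal.rpow_zero, one_mul]
  calc eLpNormDistrib p (lpBlock ((n : ℤ) + 1) u)
      = (2 : ℝ≥0∞) ^ (-((((n : ℤ) + 1 : ℤ) : ℝ) * s)) * ((2 : ℝ≥0∞) ^ ((((n : ℤ) + 1 : ℤ) : ℝ) * s) *
          eLpNormDistrib p (lpBlock ((n : ℤ) + 1) u)) := h2.symm
    _ ≤ (2 : ℝ≥0∞) ^ (-((((n : ℤ) + 1 : ℤ) : ℝ) * s)) * eLpNorm (lpBlockWeightSucc s p u) ∞ Measure.count := by
        gcongr

/-- The embedding `L^∞ → 𝓢'` is additive. (Private twin of `coe_add_toTemperedDistribution` of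
`LittlewoodPaleyHolderProofs.lean`, not imported here.) [folklore] -/
private theorem coe_add_toTemperedDistribution' (a b : Lp F ∞ (volume : Measure E)) :
    (((a + b : Lp F ∞ (volume : Measure E))) : 𝓢'(E, F)) = (a : 𝓢'(E, F)) + (b : 𝓢'(E, F)) := by
  rw [← Lp.toTemperedDistributionCLM_apply, ← Lp.toTemperedDistributionCLM_apply,
    ← Lp.toTemperedDistributionCLM_apply, map_add]

end Twins

/-! ## `B^{k+r}_{∞,∞} ⊂ C^{k,r}_b` -/

section BesovToHolder

variable {E : Type*} [NormedAddCommGroup E] [InnerProductSpace ℝ E] [FiniteDimensional ℝ E]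
  [MeasurableSpace E] [BorelSpace E] {F : Type*} [NormedAddCommGroup F] [NormedSpace ℂ F]
  [CompleteSpace F]

/-- **`B^{k+r}_{∞,∞} ⊂ C^{k,r}_b`** for `k ∈ ℕ`, `0 < r < 1` (Triebel 1983, Thm. 2.5.7 (ii) with
(2.5.7/9): `B^s_{∞,∞} = 𝒞^s = C^s` for `0 < s = k + r ∉ ℕ`, `C^s` being (2.2.2/3) the functions with
bounded continuous derivatives up to order `[s] = k` and `{s} = r`-Hölder derivatives of order `k`;
Grafakos, *Modern Fourier Analysis*, Thm. 1.4.9). If `u ∈ 𝓢'(E, F)` has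
`‖Ṡ₀ u‖_{L^∞} + sup_{j ≥ 1} 2^{j(k+r)} ‖Δ̇_j u‖_{L^∞} < ∞` then `u` is the distribution of an `L^∞`
function `f` with `MemContDiffHolder k r f`. Proof: `f = g₀ + ∑_{j ≥ 1} g_j` with the smooth
representatives of `Ṡ₀ u`, `Δ̇_j u` of `LittlewoodPaleyHolderHeat.lean`
(`‖Dᵐ g_j‖_∞ ≤ A_m 2^{jm} C ‖Δ̇_j u‖_∞ ≤ A_m C N 2^{j(m-k-r)}`): normally convergent together with
all derivatives of order `≤ k` (`contDiff_tsum`), the `k`-th derivatives of the terms satisfying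
`‖D^k g_j(x) - D^k g_j(y)‖ ≲ min(2^{-jr}, ‖x - y‖ 2^{j(1-r)})` (sup bound, resp. mean value
inequality with `D^{k+1} g_j`), which sums to `≲ ‖x - y‖^r`
(`exists_tsum_min_mul_rpow_neg_le`); and `[f] = u` since the partial sums represent `Ṡ_m u → u`
in `𝓢'` and converge to `f` in `L^∞`. Valid in every finite dimension (also `E = {0}`). [cite: Triebel1983, Thm. 2.5.7] -/
theorem exists_memContDiffHolder_coe_eq_of_memBesov_top_top (k : ℕ) {r : ℝ≥0} (hr₀ : 0 < r)
    (hr₁ : r < 1) (u : 𝓢'(E, F)) (hu : MemBesov ((k : ℝ) + r) ∞ ∞ u) :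
    ∃ (f : E → F) (hf : MemLp f ∞ (volume : Measure E)),
      MemContDiffHolder k r f ∧ ((hf.toLp f : Lp F ∞ (volume : Measure E)) : 𝓢'(E, F)) = u := by
  set s : ℝ := (k : ℝ) + r with hs
  have hr0 : (0 : ℝ) < r := hr₀
  have hr1 : (r : ℝ) < 1 := hr₁
  -- Step 0: the finite quantities `a₀ = ‖Ṡ₀ u‖_∞`, `N = sup_n 2^{(n+1)s} ‖Δ̇_{n+1} u‖_∞`
  have hfin : eLpNormDistrib ∞ (lowFreqCutoff 0 u) < ⊤ ∧
      eLpNorm (lpBlockWeightSucc s ∞ u) ∞ Measure.count < ⊤ := ENNReal.add_lt_top.1 hu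
  set N : ℝ≥0∞ := eLpNorm (lpBlockWeightSucc s ∞ u) ∞ Measure.count with hN
  have hNtop : N ≠ ⊤ := hfin.2.ne
  have hAle : ∀ n : ℕ, eLpNormDistrib ∞ (lpBlock ((n : ℤ) + 1) u) ≤
      (2 : ℝ≥0∞) ^ (-((((n : ℤ) + 1 : ℤ) : ℝ) * s)) * N := fun n => eLpNormDistrib_lpBlock_succ_le' s ∞ u n
  have h2t : ∀ t : ℝ, (2 : ℝ≥0∞) ^ t ≠ ⊤ := fun t => by
    rw [Ne, ENNReal.rpow_eq_top_iff]
    norm_num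
  have hblk_fin : ∀ n : ℕ, eLpNormDistrib ∞ (lpBlock ((n : ℤ) + 1) u) < ⊤ := fun n =>
    (hAle n).trans_lt (ENNReal.mul_lt_top (h2t _).lt_top hNtop.lt_top)
  -- Step 1: smooth representatives of the blocks and of `Ṡ₀ u`
  obtain ⟨A, C, hA0, hCtop, hrep⟩ := exists_smooth_rep_lpBlock (E := E) (F := F)
  choose g hgc hgb hgm hgrep using fun n : ℕ => hrep ((n : ℤ) + 1) u (hblk_fin n)
  obtain ⟨g₀, hg₀c, hg₀b, hg₀m, hg₀rep⟩ := exists_smooth_rep_lowFreqCutoff_zero u hfin.1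
  choose B₀ hB₀ using hg₀b
  -- Step 2: the bounds `‖Dᵐ g_n‖ ≤ v m n = A_m R 2^{(n+1)(m-s)}`, `R = (C N).toReal`
  set R : ℝ := (C * N).toReal with hR
  have hR0 : 0 ≤ R := ENNReal.toReal_nonneg
  set v : ℕ → ℕ → ℝ := fun m n => A m * R * (2 : ℝ) ^ ((((n : ℤ) + 1 : ℤ) : ℝ) * ((m : ℝ) - s)) with hv
  have hv0 : ∀ m n, 0 ≤ v m n := fun m n => mul_nonneg (mul_nonneg (hA0 m) hR0) (Real.rpow_nonneg zero_le_two _)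
  have hgv : ∀ (m n : ℕ) (x : E), ‖iteratedFDeriv ℝ m (g n) x‖ ≤ v m n := by
    intro m n x
    refine (hgb n m x).trans ?_
    have h1 : (C * eLpNormDistrib ∞ (lpBlock ((n : ℤ) + 1) u)).toReal ≤
        (2 : ℝ) ^ (-((((n : ℤ) + 1 : ℤ) : ℝ) * s)) * R := by
      calc (C * eLpNormDistrib ∞ (lpBlock ((n : ℤ) + 1) u)).toReal
          ≤ (C * ((2 : ℝ≥0∞) ^ (-((((n : ℤ) + 1 : ℤ) : ℝ) * s)) * N)).toReal := by
            refine ENNReal.toReal_mono (ENNReal.mul_ne_top hCtop.ne (ENNReal.mul_ne_top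
              (h2t _) hNtop)) ?_
            gcongr
            exact hAle n
        _ = (2 : ℝ) ^ (-((((n : ℤ) + 1 : ℤ) : ℝ) * s)) * R := by
            rw [mul_left_comm, ENNReal.toReal_mul, ← ENNReal.toReal_rpow, ENNReal.toReal_ofNat, hR]
    calc A m * (2 : ℝ) ^ ((((n : ℤ) + 1 : ℤ) : ℝ) * m) * (C * eLpNormDistrib ∞ (lpBlock ((n : ℤ) + 1) u)).toReal
        ≤ A m * (2 : ℝ) ^ ((((n : ℤ) + 1 : ℤ) : ℝ) * m) * ((2 : ℝ) ^ (-((((n : ℤ) + 1 : ℤ) : ℝ) * s)) * R) := by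
          gcongr
          exact mul_nonneg (hA0 m) (Real.rpow_nonneg zero_le_two _)
      _ = v m n := by
          simp only [hv]
          rw [show (((n : ℤ) + 1 : ℤ) : ℝ) * ((m : ℝ) - s) =
              (((n : ℤ) + 1 : ℤ) : ℝ) * m + -((((n : ℤ) + 1 : ℤ) : ℝ) * s) by ring,
            Real.rpow_add two_pos]
          ring
  -- geometric form of `v` and summability for `m ≤ k`
  have hvgeo : ∀ m n, v m n = A m * R * (2 : ℝ) ^ ((m : ℝ) - s) * ((2 : ℝ) ^ ((m : ℝ) - s)) ^ n := by
    intro m n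
    simp only [hv]
    rw [show (((n : ℤ) + 1 : ℤ) : ℝ) = ((n + 1 : ℕ) : ℝ) by push_cast; ring, two_rpow_natCast_mul, pow_succ]
    ring
  have hvsum : ∀ m : ℕ, m ≤ k → Summable (v m) := by
    intro m hm
    have hρ0 : 0 ≤ (2 : ℝ) ^ ((m : ℝ) - s) := Real.rpow_nonneg zero_le_two _
    have hρ1 : (2 : ℝ) ^ ((m : ℝ) - s) < 1 := by
      refine Real.rpow_lt_one_of_one_lt_of_neg one_lt_two ?_
      have : (m : ℝ) ≤ k := by exact_mod_cast hm
      rw [hs]; linarith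
    have h := (summable_geometric_of_lt_one hρ0 hρ1).mul_left (A m * R * (2 : ℝ) ^ ((m : ℝ) - s))
    refine h.congr fun n => ?_
    rw [hvgeo]
  -- Step 3: the series `G = ∑ g_n` is `C^k` with `Dᵐ G = ∑ Dᵐ g_n`, `m ≤ k`
  have hgck : ∀ n, ContDiff ℝ ((k : ℕ∞) : WithTop ℕ∞) (g n) := fun n =>
    (hgc n).of_le (by exact_mod_cast le_top)
  set G : E → F := fun x => ∑' n, g n x with hGdef
  have hvsum' : ∀ m : ℕ, (m : ℕ∞) ≤ (k : ℕ∞) → Summable (v m) := fun m hm =>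
    hvsum m (by exact_mod_cast hm)
  have hgv' : ∀ (m : ℕ) (n : ℕ) (x : E), (m : ℕ∞) ≤ (k : ℕ∞) → ‖iteratedFDeriv ℝ m (g n) x‖ ≤ v m n :=
    fun m n x _ => hgv m n x
  have hGc : ContDiff ℝ ((k : ℕ∞) : WithTop ℕ∞) G := contDiff_tsum hgck hvsum' hgv'
  have hGD : ∀ m : ℕ, m ≤ k → ∀ x, iteratedFDeriv ℝ m G x = ∑' n, iteratedFDeriv ℝ m (g n) x :=
    fun m hm x => iteratedFDeriv_tsum_apply hgck hvsum' hgv' (by exact_mod_cast hm) x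
  have hGDsum : ∀ m : ℕ, m ≤ k → ∀ x, Summable fun n => iteratedFDeriv ℝ m (g n) x := fun m hm x =>
    Summable.of_norm_bounded (hvsum m hm) fun n => hgv m n x
  have hGDb : ∀ m : ℕ, m ≤ k → ∀ x, ‖iteratedFDeriv ℝ m G x‖ ≤ ∑' n, v m n := by
    intro m hm x
    rw [hGD m hm x]
    have hs' : Summable fun n => ‖iteratedFDeriv ℝ m (g n) x‖ :=
      (hvsum m hm).of_nonneg_of_le (fun n => norm_nonneg _) fun n => hgv m n x
    exact (norm_tsum_le_tsum_norm hs').trans (Summable.tsum_le_tsum (fun n => hgv m n x) hs' (hvsum m hm))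
  -- Step 4: the function `f = g₀ + G`
  set f : E → F := fun x => g₀ x + G x with hf_def
  have hg₀ck : ContDiff ℝ ((k : ℕ∞) : WithTop ℕ∞) g₀ := hg₀c.of_le (by exact_mod_cast le_top)
  have hfc : ContDiff ℝ k f := by
    have : ContDiff ℝ ((k : ℕ∞) : WithTop ℕ∞) f := hg₀ck.add hGc
    exact_mod_cast this
  have hfD : ∀ m : ℕ, m ≤ k → ∀ x, iteratedFDeriv ℝ m f x = iteratedFDeriv ℝ m g₀ x + iteratedFDeriv ℝ m G x := by
    intro m hm x
    have h1 : ContDiffAt ℝ m g₀ x := (hg₀ck.of_le (by exact_mod_cast hm)).contDiffAt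
    have h2 : ContDiffAt ℝ m G x := (hGc.of_le (by exact_mod_cast hm)).contDiffAt
    exact iteratedFDeriv_add_apply h1 h2
  have hfDb : ∀ m : ℕ, m ≤ k → ∀ x, ‖iteratedFDeriv ℝ m f x‖ ≤ B₀ m + ∑' n, v m n := fun m hm x => by
    rw [hfD m hm x]
    exact (norm_add_le _ _).trans (add_le_add (hB₀ m x) (hGDb m hm x))
  -- Step 5: the Hölder estimate for `D^k f`
  obtain ⟨K, hKtop, hK⟩ := exists_tsum_min_mul_rpow_neg_le hr0 hr1
  -- Lipschitz bounds through `D^{k+1}`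
  have hktop : ((k : ℕ∞) : WithTop ℕ∞) < ((⊤ : ℕ∞) : WithTop ℕ∞) := by exact_mod_cast ENat.coe_lt_top k
  have hlipg₀ : ∀ x y, ‖iteratedFDeriv ℝ k g₀ x - iteratedFDeriv ℝ k g₀ y‖ ≤ B₀ (k + 1) * ‖x - y‖ := by
    intro x y
    have hd : Differentiable ℝ (iteratedFDeriv ℝ k g₀) := hg₀c.differentiable_iteratedFDeriv hktop
    refine Convex.norm_image_sub_le_of_norm_fderiv_le (s := Set.univ) (fun z _ => hd.differentiableAt)
      (fun z _ => ?_) convex_univ (Set.mem_univ y) (Set.mem_univ x)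
    rw [norm_fderiv_iteratedFDeriv]
    exact hB₀ (k + 1) z
  have hlipg : ∀ n x y, ‖iteratedFDeriv ℝ k (g n) x - iteratedFDeriv ℝ k (g n) y‖ ≤ v (k + 1) n * ‖x - y‖ := by
    intro n x y
    have hd : Differentiable ℝ (iteratedFDeriv ℝ k (g n)) := (hgc n).differentiable_iteratedFDeriv hktop
    refine Convex.norm_image_sub_le_of_norm_fderiv_le (s := Set.univ) (fun z _ => hd.differentiableAt)
      (fun z _ => ?_) convex_univ (Set.mem_univ y) (Set.mem_univ x)
    rw [norm_fderiv_iteratedFDeriv]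
    exact hgv (k + 1) n z
  -- the terms of the series: `min(2 v_k, h v_{k+1}) ≤ 2 A' R h^r m_{n+1}`
  set A' : ℝ := max (A k) (A (k + 1)) with hA'
  have hA'0 : 0 ≤ A' := (hA0 k).trans (le_max_left _ _)
  have hterm : ∀ (n : ℕ) (x y : E), x ≠ y →
      ‖iteratedFDeriv ℝ k (g n) x - iteratedFDeriv ℝ k (g n) y‖ₑ ≤
        ENNReal.ofReal (2 * A' * R * ‖x - y‖ ^ (r : ℝ)) *
          ENNReal.ofReal (min ((2 : ℝ) ^ ((n : ℤ) + 1) * ‖x - y‖) 1 *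
            ((2 : ℝ) ^ ((n : ℤ) + 1) * ‖x - y‖) ^ (-(r : ℝ))) := by
    intro n x y hxy
    have hh : 0 < ‖x - y‖ := norm_pos_iff.2 (sub_ne_zero.2 hxy)
    set j : ℤ := (n : ℤ) + 1 with hj
    have hmin : ‖iteratedFDeriv ℝ k (g n) x - iteratedFDeriv ℝ k (g n) y‖ ≤
        min (2 * v k n) (‖x - y‖ * v (k + 1) n) := by
      refine le_min ?_ ?_
      · calc _ ≤ ‖iteratedFDeriv ℝ k (g n) x‖ + ‖iteratedFDeriv ℝ k (g n) y‖ := norm_sub_le _ _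
          _ ≤ v k n + v k n := add_le_add (hgv k n x) (hgv k n y)
          _ = 2 * v k n := by ring
      · rw [mul_comm]; exact hlipg n x y
    -- rewrite the two bounds in dyadic form
    have hvk : v k n = A k * R * (2 : ℝ) ^ (-((j : ℝ) * r)) := by
      simp only [hv, hs, hj]
      congr 1
      rw [show ((k : ℝ) - ((k : ℝ) + r)) = -(r : ℝ) by ring]
      congr 1; ring
    have hvk1 : v (k + 1) n = A (k + 1) * R * (2 : ℝ) ^ ((j : ℝ) * (1 - r)) := by
      simp only [hv, hs, hj]
      congr 1
      push_cast
      rw [show ((k : ℝ) + 1 - ((k : ℝ) + r)) = 1 - (r : ℝ) by ring]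
    have hreal : min (2 * v k n) (‖x - y‖ * v (k + 1) n) ≤
        2 * A' * R * ‖x - y‖ ^ (r : ℝ) * (min ((2 : ℝ) ^ j * ‖x - y‖) 1 * ((2 : ℝ) ^ j * ‖x - y‖) ^ (-(r : ℝ))) := by
      rw [hvk, hvk1, show 2 * (A k * R * (2 : ℝ) ^ (-((j : ℝ) * r))) = (A k * R) * (2 * (2 : ℝ) ^ (-((j : ℝ) * r))) by ring,
        show ‖x - y‖ * (A (k + 1) * R * (2 : ℝ) ^ ((j : ℝ) * (1 - r))) =
          (A (k + 1) * R) * (‖x - y‖ * (2 : ℝ) ^ ((j : ℝ) * (1 - r))) by ring]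
      refine (min_mul_le_max_mul_min (A k * R) (A (k + 1) * R) (by positivity) (by positivity)).trans ?_
      have hmax : max (A k * R) (A (k + 1) * R) = A' * R := by
        rw [hA', max_mul_of_nonneg _ _ hR0]
      rw [hmax]
      calc A' * R * min (2 * (2 : ℝ) ^ (-((j : ℝ) * r))) (‖x - y‖ * (2 : ℝ) ^ ((j : ℝ) * (1 - r)))
          ≤ A' * R * (2 * ‖x - y‖ ^ (r : ℝ) * (min ((2 : ℝ) ^ j * ‖x - y‖) 1 * ((2 : ℝ) ^ j * ‖x - y‖) ^ (-(r : ℝ)))) :=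
            mul_le_mul_of_nonneg_left (min_two_rpow_le_two_mul_rpow_mul j r hh) (mul_nonneg hA'0 hR0)
        _ = _ := by ring
    rw [← ofReal_norm, ← ENNReal.ofReal_mul (by positivity)]
    exact ENNReal.ofReal_le_ofReal (hmin.trans hreal)
  -- summing over `n`
  have hseries : ∀ x y : E, ‖iteratedFDeriv ℝ k G x - iteratedFDeriv ℝ k G y‖ₑ ≤
      ENNReal.ofReal (2 * A' * R * ‖x - y‖ ^ (r : ℝ)) * K := by
    intro x y
    rcases eq_or_ne x y with rfl | hxy
    · rw [← edist_eq_enorm_sub, edist_self]; exact zero_le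
    have hh : 0 < ‖x - y‖ := norm_pos_iff.2 (sub_ne_zero.2 hxy)
    have hsumk : Summable (v k) := hvsum k le_rfl
    have hds : Summable fun n => ‖iteratedFDeriv ℝ k (g n) x - iteratedFDeriv ℝ k (g n) y‖ :=
      (hsumk.add hsumk).of_nonneg_of_le (fun n => norm_nonneg _) fun n =>
        (norm_sub_le _ _).trans (add_le_add (hgv k n x) (hgv k n y))
    rw [hGD k le_rfl x, hGD k le_rfl y, ← Summable.tsum_sub (hGDsum k le_rfl x) (hGDsum k le_rfl y)]
    calc ‖∑' n, (iteratedFDeriv ℝ k (g n) x - iteratedFDeriv ℝ k (g n) y)‖ₑ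
        = ENNReal.ofReal ‖∑' n, (iteratedFDeriv ℝ k (g n) x - iteratedFDeriv ℝ k (g n) y)‖ := (ofReal_norm _).symm
      _ ≤ ENNReal.ofReal (∑' n, ‖iteratedFDeriv ℝ k (g n) x - iteratedFDeriv ℝ k (g n) y‖) :=
          ENNReal.ofReal_le_ofReal (norm_tsum_le_tsum_norm hds)
      _ = ∑' n, ENNReal.ofReal ‖iteratedFDeriv ℝ k (g n) x - iteratedFDeriv ℝ k (g n) y‖ :=
          ENNReal.ofReal_tsum_of_nonneg (fun n => norm_nonneg _) hds
      _ = ∑' n, ‖iteratedFDeriv ℝ k (g n) x - iteratedFDeriv ℝ k (g n) y‖ₑ := by simp_rw [ofReal_norm]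
      _ ≤ ∑' n : ℕ, ENNReal.ofReal (2 * A' * R * ‖x - y‖ ^ (r : ℝ)) *
            ENNReal.ofReal (min ((2 : ℝ) ^ ((n : ℤ) + 1) * ‖x - y‖) 1 *
              ((2 : ℝ) ^ ((n : ℤ) + 1) * ‖x - y‖) ^ (-(r : ℝ))) := ENNReal.tsum_le_tsum fun n => hterm n x y hxy
      _ = ENNReal.ofReal (2 * A' * R * ‖x - y‖ ^ (r : ℝ)) * ∑' n : ℕ,
            ENNReal.ofReal (min ((2 : ℝ) ^ ((n : ℤ) + 1) * ‖x - y‖) 1 *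
              ((2 : ℝ) ^ ((n : ℤ) + 1) * ‖x - y‖) ^ (-(r : ℝ))) := by rw [ENNReal.tsum_mul_left]
      _ ≤ ENNReal.ofReal (2 * A' * R * ‖x - y‖ ^ (r : ℝ)) * ∑' j : ℤ,
            ENNReal.ofReal (min ((2 : ℝ) ^ j * ‖x - y‖) 1 * ((2 : ℝ) ^ j * ‖x - y‖) ^ (-(r : ℝ))) := by
          gcongr
          exact ENNReal.tsum_comp_le_tsum_of_injective (f := fun n : ℕ => (n : ℤ) + 1)
            (fun a b hab => by simpa using hab)
            (fun j : ℤ => ENNReal.ofReal (min ((2 : ℝ) ^ j * ‖x - y‖) 1 * ((2 : ℝ) ^ j * ‖x - y‖) ^ (-(r : ℝ))))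
      _ ≤ ENNReal.ofReal (2 * A' * R * ‖x - y‖ ^ (r : ℝ)) * K := by
          gcongr
          exact hK ‖x - y‖ hh
  -- the `g₀` part and the total Hölder bound
  set L : ℝ≥0∞ := ENNReal.ofReal (B₀ (k + 1) + 2 * B₀ k) + ENNReal.ofReal (2 * A' * R) * K with hL
  have hLtop : L ≠ ⊤ := ENNReal.add_ne_top.2 ⟨ENNReal.ofReal_ne_top, ENNReal.mul_ne_top ENNReal.ofReal_ne_top hKtop⟩
  have hHolder : ∀ x y : E, edist (iteratedFDeriv ℝ k f x) (iteratedFDeriv ℝ k f y) ≤ L * edist x y ^ (r : ℝ) := by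
    intro x y
    have hB0 : 0 ≤ B₀ (k + 1) := (norm_nonneg _).trans (hB₀ (k + 1) x)
    have h0 := norm_sub_le_add_mul_rpow_of_lipschitz_of_bound hB0 hlipg₀ (hB₀ k) hr0.le hr1.le x y
    have h0e : ‖iteratedFDeriv ℝ k g₀ x - iteratedFDeriv ℝ k g₀ y‖ₑ ≤
        ENNReal.ofReal (B₀ (k + 1) + 2 * B₀ k) * ‖x - y‖ₑ ^ (r : ℝ) := by
      rw [← ofReal_norm, ← ofReal_norm, ENNReal.ofReal_rpow_of_nonneg (norm_nonneg _) hr0.le,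
        ← ENNReal.ofReal_mul (by linarith [(norm_nonneg _).trans (hB₀ k x)])]
      exact ENNReal.ofReal_le_ofReal h0
    have hGe : ‖iteratedFDeriv ℝ k G x - iteratedFDeriv ℝ k G y‖ₑ ≤
        ENNReal.ofReal (2 * A' * R) * K * ‖x - y‖ₑ ^ (r : ℝ) := by
      refine (hseries x y).trans (le_of_eq ?_)
      rw [ENNReal.ofReal_mul (by positivity), ← ofReal_norm, ENNReal.ofReal_rpow_of_nonneg (norm_nonneg _) hr0.le]
      ring
    rw [hfD k le_rfl x, hfD k le_rfl y]
    calc edist (iteratedFDeriv ℝ k g₀ x + iteratedFDeriv ℝ k G x) (iteratedFDeriv ℝ k g₀ y + iteratedFDeriv ℝ k G y)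
        ≤ edist (iteratedFDeriv ℝ k g₀ x) (iteratedFDeriv ℝ k g₀ y) + edist (iteratedFDeriv ℝ k G x) (iteratedFDeriv ℝ k G y) :=
          edist_add_add_le _ _ _ _
      _ = ‖iteratedFDeriv ℝ k g₀ x - iteratedFDeriv ℝ k g₀ y‖ₑ + ‖iteratedFDeriv ℝ k G x - iteratedFDeriv ℝ k G y‖ₑ := by
          rw [edist_eq_enorm_sub, edist_eq_enorm_sub]
      _ ≤ ENNReal.ofReal (B₀ (k + 1) + 2 * B₀ k) * ‖x - y‖ₑ ^ (r : ℝ) +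
          ENNReal.ofReal (2 * A' * R) * K * ‖x - y‖ₑ ^ (r : ℝ) := add_le_add h0e hGe
      _ = L * edist x y ^ (r : ℝ) := by rw [hL, edist_eq_enorm_sub]; ring
  have hHW : HolderWith L.toNNReal r (iteratedFDeriv ℝ k f) := by
    intro x y
    rw [ENNReal.coe_toNNReal hLtop]
    exact hHolder x y
  -- Step 6: `f ∈ C^{k,r}_b ∩ L^∞`
  have hfcont : Continuous f := hfc.continuous
  have hfB : ∀ x, ‖f x‖ ≤ B₀ 0 + ∑' n, v 0 n := fun x => by
    have h := hfDb 0 (Nat.zero_le k) x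
    rwa [norm_iteratedFDeriv_zero] at h
  have hfm : MemLp f ∞ (volume : Measure E) :=
    memLp_top_of_bound hfcont.aestronglyMeasurable _ (Eventually.of_forall hfB)
  have hmem : MemContDiffHolder k r f := by
    refine ⟨hfc, fun m hm => ?_, ⟨L.toNNReal, hHW⟩⟩
    exact eSupNorm_lt_top_iff.2 ⟨_, hfDb m hm⟩
  refine ⟨f, hfm, hmem, ?_⟩
  -- Step 7: `[f] = u`: the partial sums represent `Ṡ_m u → u`, and converge to `f` in `L^∞`
  have hsum0 : Summable (v 0) := hvsum 0 (Nat.zero_le k)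
  have hgbd : ∀ n x, ‖g n x‖ ≤ v 0 n := fun n x => by
    have h := hgv 0 n x
    rwa [norm_iteratedFDeriv_zero] at h
  have hgsum : ∀ x, Summable fun n => g n x := fun x => Summable.of_norm_bounded hsum0 fun n => hgbd n x
  set Fm : ℕ → E → F := fun m x => g₀ x + ∑ n ∈ Finset.range m, g n x with hFm
  have hFm_mem : ∀ m, MemLp (Fm m) ∞ (volume : Measure E) := fun m =>
    hg₀m.add (memLp_finsetSum _ (fun n _ => hgm n))
  have hFm_coe : ∀ m : ℕ, (((hFm_mem m).toLp (Fm m) : Lp F ∞ (volume : Measure E)) : 𝓢'(E, F)) =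
      lowFreqCutoff (m : ℤ) u := by
    intro m
    induction m with
    | zero =>
        have h0 : (hFm_mem 0).toLp (Fm 0) = hg₀m.toLp g₀ := by
          rw [MemLp.toLp_eq_toLp_iff]
          exact Eventually.of_forall fun x => by simp [hFm]
        rw [h0, hg₀rep, Nat.cast_zero]
    | succ m ih =>
        have h1 : (hFm_mem (m + 1)).toLp (Fm (m + 1)) = (hFm_mem m).toLp (Fm m) + (hgm m).toLp (g m) := by
          rw [← MemLp.toLp_add, MemLp.toLp_eq_toLp_iff]
          exact Eventually.of_forall fun x => by simp [hFm, Finset.sum_range_succ, add_assoc]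
        rw [h1, coe_add_toTemperedDistribution', ih, hgrep m, lpBlock_eq_sub_holds ((m : ℤ) + 1),
          FunLike.coe_sub, Pi.sub_apply, add_sub_cancel_right, Nat.cast_succ, add_sub_cancel]
  have hlim1 : Tendsto (fun m : ℕ => (((hFm_mem m).toLp (Fm m) : Lp F ∞ (volume : Measure E)) : 𝓢'(E, F)))
      atTop (𝓝 u) := by
    simp_rw [hFm_coe]
    exact (tendsto_lowFreqCutoff_atTop_distribution u).comp tendsto_natCast_atTop_atTop
  have hdist : ∀ m, ‖(hFm_mem m).toLp (Fm m) - hfm.toLp f‖ ≤ ∑' i, v 0 (i + m) := by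
    intro m
    have hsA : Summable fun i => v 0 (i + m) := (summable_nat_add_iff (f := v 0) m).2 hsum0
    have hpt : ∀ x, ‖(Fm m - f) x‖ ≤ ∑' i, v 0 (i + m) := by
      intro x
      have hsk : Summable fun i => ‖g (i + m) x‖ :=
        hsA.of_nonneg_of_le (fun i => norm_nonneg _) fun i => hgbd (i + m) x
      have heq : (Fm m - f) x = -∑' i, g (i + m) x := by
        simp only [Pi.sub_apply, hFm, hf_def, hGdef]
        rw [← Summable.sum_add_tsum_nat_add m (hgsum x)]
        abel
      rw [heq, norm_neg]
      exact (norm_tsum_le_tsum_norm hsk).trans (Summable.tsum_le_tsum (fun i => hgbd (i + m) x) hsk hsA)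
    rw [← MemLp.toLp_sub, Lp.norm_toLp]
    refine ENNReal.toReal_le_of_le_ofReal (tsum_nonneg fun i => hv0 0 (i + m)) ?_
    rw [eLpNorm_exponent_top]
    exact eLpNormEssSup_le_of_ae_bound (Eventually.of_forall hpt)
  have htail : Tendsto (fun m : ℕ => ∑' i, v 0 (i + m)) atTop (𝓝 0) := tendsto_sum_nat_add (v 0)
  have hlim2 : Tendsto (fun m : ℕ => ((hFm_mem m).toLp (Fm m) : Lp F ∞ (volume : Measure E))) atTop
      (𝓝 (hfm.toLp f)) := by
    rw [tendsto_iff_norm_sub_tendsto_zero]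
    exact squeeze_zero (fun m => norm_nonneg _) hdist htail
  have hlim3 : Tendsto (fun m : ℕ => (((hFm_mem m).toLp (Fm m) : Lp F ∞ (volume : Measure E)) : 𝓢'(E, F)))
      atTop (𝓝 ((hfm.toLp f : Lp F ∞ (volume : Measure E)) : 𝓢'(E, F))) :=
    ((Lp.toTemperedDistributionCLM F (volume : Measure E) ∞).continuous.tendsto _).comp hlim2
  exact tendsto_nhds_unique hlim3 hlim1

end BesovToHolder

/-! ## The characterisation -/

section Characterisation

variable {E : Type*} [NormedAddCommGroup E] [InnerProductSpace ℝ E] [FiniteDimensional ℝ E]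
  [MeasurableSpace E] [BorelSpace E] {F : Type*} [NormedAddCommGroup F] [NormedSpace ℂ F]
  [CompleteSpace F]

/-- **Discharge of the named fact `memBesov_top_top_iff_memContDiffHolder`:
`B^{k+r}_{∞,∞} = C^{k,r}_b` for `k ∈ ℕ`, `0 < r < 1`** (Triebel 1983, Thm. 2.5.7 (ii), eq. (6):
`𝒞^s(ℝⁿ) = B^s_{∞,∞}(ℝⁿ)` for `s > 0`, with eq. (9): `C^s(ℝⁿ) = 𝒞^s(ℝⁿ)` for `0 < s ∉ ℕ`, where
`C^s`, `s = k + r`, is (2.2.2/3) the space of `f ∈ C^k` with bounded (uniformly continuous)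
derivatives up to order `k` and `r`-Hölder derivatives of order `k`; held copy, PDF pp. 151,
218–220). A tempered distribution `u` lies in `B^{k+r}_{∞,∞}` (finite
`‖Ṡ₀ u‖_{L^∞} + sup_{j ≥ 1} 2^{j(k+r)} ‖Δ̇_j u‖_{L^∞}`) iff it is the distribution of an `L^∞` function
in `C^{k,r}_b` (`exists_memContDiffHolder_coe_eq_of_memBesov_top_top`,
`memBesov_top_top_coe_of_memContDiffHolder`). The proof is dimension-free (also `E = {0}`).
[cite: Triebel1983, Thm. 2.5.7] -/
theorem memBesov_top_top_iff_memContDiffHolder_holds :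
    memBesov_top_top_iff_memContDiffHolder (E := E) (F := F) := by
  intro k r hr₀ hr₁ u
  constructor
  · exact exists_memContDiffHolder_coe_eq_of_memBesov_top_top k hr₀ hr₁ u
  · rintro ⟨f, hf, hH, rfl⟩
    exact memBesov_top_top_coe_of_memContDiffHolder hH hf

end Characterisation

end Literature.Analysis.FunctionSpaces
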